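import Mathlib
import HarnessLib
import Summits.HubbardSuperconductivity.Statement
import Summits.HubbardSuperconductivity.HubbardSuperconductivity.Theses.DeformationLadder
import Literature.MathematicalPhysics.QuantumLattice.MagneticHubbardTorus
import Literature.MathematicalPhysics.QuantumLattice.HubbardTorusFlux

/-!
# Sketch — crux-ideate stmt-HubbardSuperconductivity-1892 (LowEnergyRigidity), ideator 2, round 1

First lemmas of the idea card `gauge-orbit-ironing` (they need not be proved here; they must
elaborate). Namespace of the crux's route.
-/

namespace Summit.HubbardSuperconductivity.HubbardSuperconductivity.Cruxes.LowEnergyRigidity.GaugeOrbitIroning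

open Literature.MathematicalPhysics.QuantumLattice Literature.MathematicalPhysics.QuantumFieldTheory
open Literature.Probability.LatticeModels Matrix

/-- The pure-gauge field `dθ` of a real site function `θ` on the torus `(ℤ/L)²`:
`(x, i) ↦ e^{iθ_x} · 1 · e^{-iθ_{x+eᵢ}}` (the tree's `gaugeTransform` of the trivial field). -/
noncomputable def pureGauge (L : ℕ) (θ : Site 2 L → ℝ) : GaugeConfig 2 L Circle :=
  gaugeTransform (fun x => Circle.exp (θ x)) 1

/-- Bond hop `c†_{x+eᵢ,σ} c_{x,σ}` on the fermionic torus (the operator whose real/imaginary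
expectation parts are the bond kinetic energy and the bond current). -/
noncomputable def hop (L : ℕ) [NeZero L] (x : Site 2 L) (i : Fin 2) (σ : Fin 2) :
    Matrix (Finset (Orb (FermionTorus 2 L))) (Finset (Orb (FermionTorus 2 L))) ℂ :=
  creation (orb (FermionTorus.ofTorusSite (Site.shift x i)) σ) *
    annihilation (orb (FermionTorus.ofTorusSite x) σ)

/-- **Master first lemma (diamagnetic pricing; provable now — it is the variational principle for
`H_A` on the sector plus the bond-by-bond unfolding of `H − H_A`).** For EVERY lattice `U(1)` gauge field
`A` (Peierls phases `a_{x,i} = A(x,i)`), every unit sector vector `φ` pays at least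
`[E₀(H_A) − E₀(H)] + Σ_{x,i,σ} [ −2(1 − Re a_{x,i}) Re h_{x,i,σ}(φ) − 2 Im a_{x,i} · Im h_{x,i,σ}(φ) ]`
above the sector ground energy, `h_{x,i,σ}(φ) = ⟨φ, c†_{x+eᵢ,σ} c_{x,σ} φ⟩`. Pure gauges `A = dθ` have
`E₀(H_A) = E₀(H)` (ironing); Aharonov–Bohm fluxes and flux pairs bring in the tree's magnetic landscape
(`fluxEnergy`, `fluxResponse`) as the price list for windings and coarse vortices. -/
def DiamagneticPricing : Prop :=
  ∀ (L : ℕ) [NeZero L], 3 ≤ L → ∀ (U : ℝ) (N : ℕ) (M : ℝ) (A : GaugeConfig 2 L Circle)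
    (φ : Fock (Orb (FermionTorus 2 L))), φ ∈ szSector N M → star φ ⬝ᵥ φ = 1 →
    ((magneticHubbardTorus L A 1 U).minEnergyOn (szSector N M) -
        (hubbardTorus 2 L 1 U).minEnergyOn (szSector N M)) +
      (∑ x : Site 2 L, ∑ i : Fin 2, ∑ σ : Fin 2,
        (-2 * (1 - ((A (x, i) : Circle) : ℂ).re) * (star φ ⬝ᵥ (hop L x i σ *ᵥ φ)).re
          - 2 * ((A (x, i) : Circle) : ℂ).im * (star φ ⬝ᵥ (hop L x i σ *ᵥ φ)).im)) ≤
      (star φ ⬝ᵥ (hubbardTorus 2 L 1 U *ᵥ φ)).re -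
        (hubbardTorus 2 L 1 U).minEnergyOn (szSector N M)

/-- **Gauge invariance of sector energies (provable now; the companion fact announced in
`MagneticHubbardTorus.lean`, not yet in the tree): pure gauges are isospectral on every sector.** -/
def PureGaugeIsospectral : Prop :=
  ∀ (L : ℕ) [NeZero L], 3 ≤ L → ∀ (U : ℝ) (N : ℕ) (M : ℝ) (θ : Site 2 L → ℝ),
    (magneticHubbardTorus L (pureGauge L θ) 1 U).minEnergyOn (szSector N M) =
      (hubbardTorus 2 L 1 U).minEnergyOn (szSector N M)

/-- **First lemma (ironing inequality, variational half; provable now).** For every real site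
function `θ` the pure-gauge Hamiltonian `H_{dθ}` is unitarily equivalent to `hubbardTorus 2 L 1 U`
by the sector-preserving site-phase unitary `phaseGauge`, hence has the same sector ground energy;
so the sector ground energy of the PURE model is bounded above by the `H_{dθ}`-energy of ANY unit
sector vector `φ` — for every `θ` (a one-real-parameter family `s • θ` included). -/
def IroningVariational : Prop :=
  ∀ (L : ℕ) [NeZero L], 3 ≤ L → ∀ (U : ℝ) (N : ℕ) (M : ℝ) (θ : Site 2 L → ℝ)
    (φ : Fock (Orb (FermionTorus 2 L))), φ ∈ szSector N M → star φ ⬝ᵥ φ = 1 →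
    (hubbardTorus 2 L 1 U).minEnergyOn (szSector N M) ≤
      (star φ ⬝ᵥ (magneticHubbardTorus L (pureGauge L θ) 1 U *ᵥ φ)).re

/-- **First lemma, quantitative form (ironing lower bound on the excitation energy; provable now
from `IroningVariational` by expanding the Peierls phases).** For every unit sector vector `φ`,
every real `θ` and every amplitude `s`, writing `h_{x,i,σ}(φ) = ⟨φ, c†_{x+eᵢ,σ}c_{x,σ} φ⟩` and
`δθ_{x,i} = θ_x − θ_{x+eᵢ}`:
`⟨φ,Hφ⟩ − E₀ ≥ Σ_{x,i,σ} [ −2(1 − cos(s δθ_{x,i})) Re h_{x,i,σ}(φ) − 2 sin(s δθ_{x,i}) Im h_{x,i,σ}(φ) ]`.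
Optimising the right side in `s` (1 − cos u ≤ u²/2, sin u = u + O(u³)) gives the Cauchy–Schwarz
form `⟨φ,Hφ⟩ − E₀ ≥ (Σ δθ·j)² / (2 Σ δθ²·k) − cubic`, `j = −2 Im h` the bond current,
`k = 2 Re h` the bond kinetic weight. -/
def IroningLowerBound : Prop :=
  ∀ (L : ℕ) [NeZero L], 3 ≤ L → ∀ (U : ℝ) (N : ℕ) (M : ℝ) (θ : Site 2 L → ℝ) (s : ℝ)
    (φ : Fock (Orb (FermionTorus 2 L))), φ ∈ szSector N M → star φ ⬝ᵥ φ = 1 →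
    (∑ x : Site 2 L, ∑ i : Fin 2, ∑ σ : Fin 2,
        (-2 * (1 - Real.cos (s * (θ x - θ (Site.shift x i)))) *
            (star φ ⬝ᵥ (hop L x i σ *ᵥ φ)).re
          - 2 * Real.sin (s * (θ x - θ (Site.shift x i))) *
            (star φ ⬝ᵥ (hop L x i σ *ᵥ φ)).im)) ≤
      (star φ ⬝ᵥ (hubbardTorus 2 L 1 U *ᵥ φ)).re -
        (hubbardTorus 2 L 1 U).minEnergyOn (szSector N M)

/-- **Bloch-margin form for the harmonic (winding) part (provable now; the flux-threaded sector
energy is the tree's `fluxEnergy`).** Uniform current costs energy quadratically up to the flux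
deficit: for every unit sector vector `φ` and every flux `Φ`, with `K(φ) = Σ_{x,σ} 2Re h_{x,0,σ}`
(x-kinetic weight) and `J(φ) = Σ_{x,σ} (−2) Im h_{x,0,σ}` (total x-current),
`⟨φ,Hφ⟩ − E₀ ≥ [fluxEnergy(Φ) − fluxEnergy(0)] − (1 − cos(Φ/L)) K(φ) − sin(Φ/L) J(φ)`,
because `H` with the uniform twist `e^{iΦ/L}` on every `e₀`-bond is gauge-equivalent to the
seam-twisted `hubbardTorusFlux L U Φ`. Choosing `Φ/L = −arctan(J/K)` gives
`⟨φ,Hφ⟩ − E₀ ≥ (√(K²+J²) − K) − [fluxEnergy(0) − fluxEnergy(Φ*)]₊ ≈ J²/2K − deficit`. -/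
def BlochMargin : Prop :=
  ∀ (L : ℕ) [NeZero L], 3 ≤ L → ∀ (U δ Φ : ℝ)
    (φ : Fock (Orb (FermionTorus 2 L))),
    φ ∈ szSector (2 * ⌊(1 - δ) * (L : ℝ) ^ 2 / 2⌋₊) 0 → star φ ⬝ᵥ φ = 1 →
    (fluxEnergy L U δ Φ - fluxEnergy L U δ 0)
      - (1 - Real.cos (Φ / L)) *
          (∑ x : Site 2 L, ∑ σ : Fin 2, 2 * (star φ ⬝ᵥ (hop L x 0 σ *ᵥ φ)).re)
      + Real.sin (Φ / L) *
          (∑ x : Site 2 L, ∑ σ : Fin 2, 2 * (star φ ⬝ᵥ (hop L x 0 σ *ᵥ φ)).im) ≤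
      (star φ ⬝ᵥ (hubbardTorus 2 L 1 U *ᵥ φ)).re -
        (hubbardTorus 2 L 1 U).minEnergyOn (szSector (2 * ⌊(1 - δ) * (L : ℝ) ^ 2 / 2⌋₊) 0)

/-- Sanity: the crux decl is in scope by name. -/
example : Prop := Summit.HubbardSuperconductivity.HubbardSuperconductivity.Theses.DeformationLadder.LowEnergyRigidity

end Summit.HubbardSuperconductivity.HubbardSuperconductivity.Cruxes.LowEnergyRigidity.GaugeOrbitIroning
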